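import Summits.ResolutionOfSingularities.ResolutionOfSingularities.Theses.DefectlessFrames
import Literature.Barriers.ResolutionOfSingularities.InseparableBaseChange

/-!
# Crux `ResidueTranscendenceReduction` (stmt-ResolutionOfSingularities-18875) — negative lemma: no perfect rebasing

Route `ResolutionOfSingularities/DefectlessFrames`, crux `ResidueTranscendenceReduction := ∀ p prime,
HypA p → ConcB p` (relative local uniformization at rank-one ZERO-DIMENSIONAL valuation rings over
PERFECT fields ⟹ at ALL valuation rings over perfect fields).  The classical proof of the dimension half
(Zariski 1940, C.IV §9) adjoins lifts `ξ` of a residue transcendence basis to the ground field: over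
`k' = k(ξ) ⊆ O` the valuation ring `O` becomes zero-dimensional.  In characteristic `p` this `k'` is
imperfect, so `HypA` (perfect ground fields only) does not apply to `(k', K, O)`.

`not_perfectRebase` (this file, cdisprove seat, cycle 1) shows that NO choice of intermediate ground field
repairs this: the natural strengthening

  `PerfectRebase := ∀ p prime, ∀ k perfect of char p, ∀ K/k f.g., ∀ O ⊇ k, ∃ k' intermediate, k' ⊆ O ∧
   k' perfect ∧ O zero-dimensional over k'`

is FALSE.  Mechanism (general, paper): a perfect intermediate field of a finitely generated extension of a
perfect field `k` lies in `⋂ₙ K^{pⁿ}` and is algebraic over `k`, so `O` is zero-dimensional over a perfect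
`k' ⊆ O` iff it already is over `k`.  Typed witness: `k = 𝔽₂`, `K = 𝔽₂(t)`, `O = ⊤` (residue field
`𝔽₂(t)`): `K` algebraic over a perfect `k'` would make `K` perfect (`Algebra.IsAlgebraic.perfectField`), but
`t` is not a square (`Literature.Barriers.ResolutionOfSingularities.ratFuncX_ne_pow`).  Consequence for
provers: `HypA p` is never applicable to a positive-dimensional valuation ring of the SAME valued function
field under any admissible change of ground field; the dimension half must pass through an auxiliary valued
function field over a perfect transcendental extension of `k` (e.g. `k(u)^{perf}`, `K(u^{1/p^∞})`) and then
DESCEND regularity along `K(u^{1/pⁿ}) ⊋ K` (catalogued barrier `InseparableBaseChange`).  Full analysis: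
crux workfile `Cruxes/ResidueTranscendenceReduction/Disproof.lean`.
-/

set_option linter.dupNamespace false -- mandated namespace of this single-conjunct summit

namespace Summit.ResolutionOfSingularities.ResolutionOfSingularities.Theorems.ResidueTranscendenceReduction.Negative

/-- On the trivial valuation ring of a field every non-zero element has valuation `1`. [folklore] -/
theorem valuation_top_eq_one {K : Type} [Field K] {x : K} (hx : x ≠ 0) :
    (⊤ : ValuationSubring K).valuation x = 1 := by
  have hnt : ¬ (⊤ : ValuationSubring K).valuation.IsNontrivial :=
    (ValuationSubring.eq_top_iff (⊤ : ValuationSubring K)).mp rfl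
  by_contra h1
  exact hnt ⟨x, ((⊤ : ValuationSubring K).valuation.ne_zero_iff).mpr hx, h1⟩

/-- Membership in the non-units of the trivial valuation ring means being zero. [folklore] -/
theorem mem_nonunits_top_iff {K : Type} [Field K] (x : K) :
    x ∈ (⊤ : ValuationSubring K).nonunits ↔ x = 0 := by
  rw [ValuationSubring.mem_nonunits_iff]
  refine ⟨fun h => ?_, fun h => by simp [h]⟩
  by_contra hx
  have h1 : (⊤ : ValuationSubring K).valuation x = 1 := valuation_top_eq_one hx
  rw [h1] at h
  exact lt_irrefl _ h

/-- `𝔽_p(t)` is generated by `t` over `𝔽_p`: the top intermediate field is finitely generated. [folklore] -/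
theorem fg_top_ratFunc (p : ℕ) [Fact p.Prime] :
    (⊤ : IntermediateField (ZMod p) (RatFunc (ZMod p))).FG :=
  ⟨{RatFunc.X}, by simp [RatFunc.adjoin_X]⟩

/-- Over the trivial valuation ring of `𝔽_p(t)` no perfect intermediate field makes it zero-dimensional:
`K/k'` algebraic with `k'` perfect forces `K = 𝔽_p(t)` perfect (`Algebra.IsAlgebraic.perfectField`), but
`t` is not a `p`-th power (`ratFuncX_ne_pow`). [folklore] -/
theorem not_exists_perfect_zeroDim_top (p : ℕ) [hp : Fact p.Prime] :
    ¬ ∃ k' : IntermediateField (ZMod p) (RatFunc (ZMod p)), PerfectField k' ∧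
        ∀ x ∈ (⊤ : ValuationSubring (RatFunc (ZMod p))), ∃ f : Polynomial k', f ≠ 0 ∧
          Polynomial.aeval x f ∈ (⊤ : ValuationSubring (RatFunc (ZMod p))).nonunits := by
  rintro ⟨k', hperf, hzd⟩
  haveI := hperf
  have halg : Algebra.IsAlgebraic k' (RatFunc (ZMod p)) := by
    refine ⟨fun x => ?_⟩
    obtain ⟨f, hf0, hf⟩ := hzd x (ValuationSubring.mem_top _)
    rw [mem_nonunits_top_iff] at hf
    exact ⟨f, hf0, hf⟩
  haveI : PerfectField (RatFunc (ZMod p)) := Algebra.IsAlgebraic.perfectField k'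
  haveI : CharP (RatFunc (ZMod p)) p :=
    charP_of_injective_algebraMap (algebraMap (ZMod p) (RatFunc (ZMod p))).injective p
  haveI : ExpChar (RatFunc (ZMod p)) p := ExpChar.prime hp.out
  haveI : PerfectRing (RatFunc (ZMod p)) p := PerfectField.toPerfectRing p
  obtain ⟨b, hb⟩ := (frobeniusEquiv (RatFunc (ZMod p)) p).surjective RatFunc.X
  exact Literature.Barriers.ResolutionOfSingularities.ratFuncX_ne_pow p b
    (by simpa [frobeniusEquiv, frobenius] using hb)

/-- **`PerfectRebase` is false**: it is NOT the case that every valuation ring `O ⊇ k` of a finitely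
generated extension `K` of a perfect field `k` of characteristic `p` admits a perfect intermediate ground
field `k ⊆ k' ⊆ O` over which `O` is zero-dimensional (residue field algebraic over `k'`).  Witness `p = 2`,
`k = 𝔽₂`, `K = 𝔽₂(t)`, `O = ⊤`.  So Zariski's residue-transcendence reduction (C.IV §9, `k' = k(ξ)`) cannot
be run inside the perfect ground fields over which the crux's hypothesis `HypA` is available; the general
mechanism and the rank-one form (`K = 𝔽_p(s)(t)`, `O` the `t`-adic ring) are recorded in the module
docstring and in `Cruxes/ResidueTranscendenceReduction/Disproof.lean`. [folklore] -/
theorem not_perfectRebase :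
    ¬ (∀ p : ℕ, p.Prime → ∀ (k K : Type) [Field k] [CharP k p] [PerfectField k] [Field K] [Algebra k K],
        (⊤ : IntermediateField k K).FG → ∀ O : ValuationSubring K, (∀ c : k, algebraMap k K c ∈ O) →
          ∃ k' : IntermediateField k K, (∀ c : k', (c : K) ∈ O) ∧ PerfectField k' ∧
            ∀ x ∈ O, ∃ f : Polynomial k', f ≠ 0 ∧ Polynomial.aeval x f ∈ O.nonunits) := by
  intro h
  haveI : Fact (Nat.Prime 2) := ⟨Nat.prime_two⟩
  haveI : PerfectField (ZMod 2) := PerfectField.ofFinite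
  obtain ⟨k', -, hperf, hzd⟩ := h 2 Nat.prime_two (ZMod 2) (RatFunc (ZMod 2)) (fg_top_ratFunc 2) ⊤
    (fun _ => ValuationSubring.mem_top _)
  exact not_exists_perfect_zeroDim_top 2 ⟨k', hperf, hzd⟩

end Summit.ResolutionOfSingularities.ResolutionOfSingularities.Theorems.ResidueTranscendenceReduction.Negative
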